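import Summits.QuantumFields.BalabanUV.Beta.GAN24.CombQuarticStepTransport
import Summits.QuantumFields.BalabanUV.Beta.GAN24.T2RecursionAffine
import Summits.QuantumFields.BalabanUV.Beta.GAN24.MultiplierExchangeBondSums
import Summits.QuantumFields.BalabanUV.Beta.GAN24.LinSandwichShape
import Summits.QuantumFields.BalabanUV.Beta.GAN24.LinT2CoDressed
import Summits.QuantumFields.BalabanUV.Beta.GAN24.LegPushNest
import Summits.QuantumFields.BalabanUV.Beta.SymCorrectorPair
import Summits.QuantumFields.BalabanUV.Beta.HessKerDressedUnits
import Summits.QuantumFields.BalabanUV.Beta.FP.NestedDressingKernel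

/-!
# `BalabanUV.Beta.GAN24.CombLin4Transport` — binder row G-an2-4 ∕ (CONV-C), W-slot, TRANSFER-III: **THE LINEAR STEP `lin4` OF A `Ψ̂_S`-CONJUGATED KERNEL IS THE LINEAR STEP ON THE
# FOUR-VARIABLE-TRANSPORTED BI-TABLE** ((C-1) of leaf-03's sizing note v0.5; the `lin4` twin of road-P2 g55's M.43 `e3OfK_conj_psiKS` ∕ M.45 `e4OfKW_conj_psiKS`):
# `lin4 c (Ψ̂ ∘ K ∘ Ψ̂ᵀ) n T b b′ = lin4 c K n (𝒯₄ T) b b′`, `𝒯₄ T κ u κ′ u′ := Ψ̂ᵀ ∘ (slotPsiS r n (slotPsiS r n T κ u) κ′ u′ ∘ Ψ̂)` (two source slots by the face sums —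
# d1-formalise-leaf-03's `SymCorrectorPair.vertex2OfK_conj_psiKS` —, the two kernel legs by the congruence — road-P2's M.43 §2 `conj_vertexOfK_eq_vertexOfK_conj` twice —, the outer
# correctors dropped by the `mm`-read — M.45 §1 `mmRead_conj_psiKS`), and leg units commute with the conjugation (`unitK_conj_psiKS`).

NOT IN PRINT; OUR BOOKKEEPING (G-an2-4 crux team (2), leaf prover `b2b-balaban-gan24-formalise-leaf-03`, gen 79).  [folklore] kernel bookkeeping BY NAME; 0 `def`, 0 cited facts, 0 `def … : Prop`,
0 sorry.  HONEST DEPENDENCY (verbatim): «continuum YM on T⁴ ⇐ BetaPertH ∧ nine spine estimates (0/9 proved); BetaPertH ⇐ (D1) ∧ (D4) ∧ CAP+tail; G-an2-4 gates asym, D1 and NE2/3/4.»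
WHAT THIS IS NOT: NOT the cell rows ((C-6) composes this with `PsiTableDefectOfDivergences` and leaf-06's (E) cell), NOT a letter, NOT a value; the (III′) campaign is NOT asked (an2 W-4);
zero weight; NEVER «G-an2-4 closed» as (CONV-C); NOT D1, NOT `BetaPertH`, NOT continuum, NOT Clay.  2026-08-25.
-/

noncomputable section

open Finset
open scoped BigOperators
open Literature.MathematicalPhysics.QuantumFieldTheory
open Literature.MathematicalPhysics.QuantumFieldTheory.Balaban1983to89
open Literature.MathematicalPhysics.QuantumFieldTheory.Balaban1983to89.Beta
open ExpKernelCalculus (MKer Site BiLoc Decays comp)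
open OneStepResolventKernel (Fib LocStencil)
open OneStepKernelFamily (vertexOfK)
open HessKerRate (scaleK)
open AffineAveraging (box)
open BalabanCompositeJets (LocStencil₂)
open SecondOrderResponse (vertex2OfK cBi)
open KernelWard (bdd_of_biLoc)
open Summit.QuantumFields.BalabanUV.Beta.TameKernelCalculus
open Summit.QuantumFields.BalabanUV.Beta.HessKerDressedUnits (unitK legScale legScale_inl legScale_inr)
open Summit.QuantumFields.BalabanUV.Beta.SymCorrectorKernel (psiKS psiKS_inl_inr psiKS_inr_inl spr_psiKS)
open Summit.QuantumFields.BalabanUV.Beta.ChartConjugationRelative (spr_comp)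
open Summit.QuantumFields.BalabanUV.Beta.SymCorrectorFace (slotPsiS)
open Summit.QuantumFields.BalabanUV.Beta.SymCorrectorSockets (locStencil₂_slotPsiS₂)
open Summit.QuantumFields.BalabanUV.Beta.SymCorrectorPair (vertex2OfK_conj_psiKS)
open Summit.QuantumFields.BalabanUV.Beta.KernelWardCoarseExchange (comp_add_of_bdd add_comp_of_bdd abs_comp_le_of_spr_left)
open Summit.QuantumFields.BalabanUV.Beta.FP.NestedDressingKernel (comp_scaleK_of_comm scaleK_comp_of_comm)
open Summit.QuantumFields.BalabanUV.Beta.GAN24.T2RecursionAffine (lin4 vsym lin4_apply)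
open Summit.QuantumFields.BalabanUV.Beta.GAN24.LinT2CoDressed (locStencil_slice locStencil_vertexOfK_slice)
open Summit.QuantumFields.BalabanUV.Beta.GAN24.MultiplierExchangeBondSums (loc_vertexOfK)
open Summit.QuantumFields.BalabanUV.Beta.GAN24.LinSandwichShape (biLoc_vsym_far)
open Summit.QuantumFields.BalabanUV.Beta.GAN24.LegPushNest (comp_smul_right)
open Summit.QuantumFields.BalabanUV.Beta.GAN24.CombCubicStepTransport (conj_vertexOfK_eq_vertexOfK_conj)
open Summit.QuantumFields.BalabanUV.Beta.GAN24.CombQuarticStepTransport (mmRead_conj_psiKS)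

namespace Summit.QuantumFields.BalabanUV.Beta.GAN24.CombLin4Transport

variable {d : ℕ} {n : ℕ} (hn : 0 < n) {r : Fin (d + 1) → ℕ} (hr : r ∈ box (d + 1) n)

/-! ## §1 Leg units commute with the `Ψ̂_S` conjugation -/

section Units

variable (r) (n) (sf sm : ℝ)

omit hn hr in
/-- [folklore] `Ψ̂_S` preserves the leg type: `Ψ̂ x y a b · s(b) = s(a) · Ψ̂ x y a b` for leg-type-constant weights. -/
theorem psiKS_mul_legScale (x y : Fin (d + 1) → ℤ) (a b : Fib d) : psiKS r n x y a b * legScale sf sm b = legScale sf sm a * psiKS r n x y a b := by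
  rcases a with α | m <;> rcases b with β | m'
  · rw [legScale_inl, legScale_inl, mul_comm]
  · rw [psiKS_inl_inr, zero_mul, mul_zero]
  · rw [psiKS_inr_inl, zero_mul, mul_zero]
  · rw [legScale_inr, legScale_inr, mul_comm]

omit hn hr in
/-- [folklore] … and for `Ψ̂_Sᵀ`: `s(f) · Ψ̂ᵀ y z f c = Ψ̂ᵀ y z f c · s(c)`. -/
theorem legScale_mul_trK_psiKS (y z : Fin (d + 1) → ℤ) (f c : Fib d) : legScale sf sm f * trK (psiKS r n) y z f c = trK (psiKS r n) y z f c * legScale sf sm c := by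
  rw [trK_apply]
  rcases f with α | m <;> rcases c with β | m'
  · rw [legScale_inl, legScale_inl, mul_comm]
  · rw [psiKS_inr_inl, zero_mul, mul_zero]
  · rw [psiKS_inl_inr, zero_mul, mul_zero]
  · rw [legScale_inr, legScale_inr, mul_comm]

omit hn hr in
/-- [folklore] **LEG UNITS COMMUTE WITH THE `Ψ̂_S` CONJUGATION**: `unitK s_f s_m (Ψ̂ ∘ K ∘ Ψ̂ᵀ) = Ψ̂ ∘ unitK s_f s_m K ∘ Ψ̂ᵀ` (road FP's `comp_scaleK_of_comm ∕ scaleK_comp_of_comm`). -/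
theorem unitK_conj_psiKS (K : MKer (d + 1) (Fib d)) :
    unitK sf sm (comp (comp (psiKS r n) K) (trK (psiKS r n))) = comp (comp (psiKS r n) (unitK sf sm K)) (trK (psiKS r n)) := by
  unfold unitK
  rw [comp_scaleK_of_comm (psiKS_mul_legScale n r sf sm), scaleK_comp_of_comm (legScale_mul_trK_psiKS n r sf sm)]

end Units

/-! ## §2 The symmetrised bi-vertex of a conjugated kernel and its leg congruence -/

include hn hr

/-- [folklore] **THE SYMMETRISED BI-VERTEX OF `Ψ̂ ∘ K ∘ Ψ̂ᵀ` IS THE ONE OF `K` ON THE DOUBLY SLOT-TRANSPORTED TABLE** (d1-formalise-leaf-03's `vertex2OfK_conj_psiKS` on both summands). -/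
theorem vsym_conj_psiKS {K : MKer (d + 1) (Fib d)} (hK : Spr K)
    {T : Fin (d + 1) → Site (d + 1) → Fin (d + 1) → Site (d + 1) → MKer (d + 1) (Fib d)} {CT δT : ℝ} (hT : LocStencil₂ T CT δT) (hδT : 0 < δT)
    (μ : Fin (d + 1)) (y : Site (d + 1)) (ν : Fin (d + 1)) (y' : Site (d + 1)) :
    vsym (comp (comp (psiKS r n) K) (trK (psiKS r n))) n T μ y ν y' = vsym K n (fun α x => slotPsiS r n (slotPsiS r n T α x)) μ y ν y' := by
  unfold vsym
  rw [vertex2OfK_conj_psiKS hn hr hK hT hδT μ y ν y', vertex2OfK_conj_psiKS hn hr hK hT hδT ν y' μ y]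

omit hn hr in
/-- [folklore] **THE LEG CONGRUENCE OF THE SYMMETRISED BI-VERTEX PASSES TO THE TABLE ENTRIES** (spread `P`, spread `K`, `LocStencil₂` table at a positive rate): `Pᵀ ∘ vsym K n T b b′ ∘ P =
vsym K n (κ u κ′ u′ ↦ Pᵀ ∘ T κ u κ′ u′ ∘ P) b b′` — road-P2 g55's M.43 §2 `conj_vertexOfK_eq_vertexOfK_conj` twice per summand (the vertex's column weights are scalars), the congruence
distributed over `½ • (· + ·)` by an5's bounded-additivity of `comp`. -/
theorem conj_vsym_eq_vsym_conj {P K : MKer (d + 1) (Fib d)} (hP : Spr P) (hK : Spr K)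
    {T : Fin (d + 1) → Site (d + 1) → Fin (d + 1) → Site (d + 1) → MKer (d + 1) (Fib d)} {CT δT : ℝ} (hT : LocStencil₂ T CT δT) (hδT : 0 < δT)
    (μ : Fin (d + 1)) (y : Site (d + 1)) (ν : Fin (d + 1)) (y' : Site (d + 1)) :
    comp (comp (trK P) (vsym K n T μ y ν y')) P = vsym K n (fun κ u κ' u' => comp (comp (trK P) (T κ u κ' u')) P) μ y ν y' := by
  obtain ⟨CK, δK, hδK, hKd⟩ := id hK
  have hK2 : ∃ δ C : ℝ, 0 < δ ∧ 0 ≤ C ∧ Decays K C δ := ⟨δK, |CK|, hδK, abs_nonneg CK, decays_of_le hKd le_rfl⟩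
  -- common rate
  set m : ℝ := min δK δT with hm
  have hm0 : 0 < m := lt_min hδK hδT
  have hKm : Decays K (|CK|) m := decays_of_le hKd (min_le_left _ _)
  have hTm : LocStencil₂ T CT m := hT.mono (min_le_right _ _)
  -- the two vertex words, conjugated
  have conj2 : ∀ (b : Fin (d + 1)) (w : Site (d + 1)) (b' : Fin (d + 1)) (w' : Site (d + 1)),
      comp (comp (trK P) (vertex2OfK K n T b w b' w')) P = vertex2OfK K n (fun κ u κ' u' => comp (comp (trK P) (T κ u κ' u')) P) b w b' w' := by
    intro b w b' w'
    -- outer vertex: its stencil family `κ u ↦ vertexOfK K n (T κ u) b' w'` is local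
    have hS := locStencil_vertexOfK_slice (N := n) hKm hm0 hTm b' w'
    unfold SecondOrderResponse.vertex2OfK
    rw [conj_vertexOfK_eq_vertexOfK_conj (N := n) hP hK2 hS hm0 b w]
    congr 1
    funext κ u
    exact conj_vertexOfK_eq_vertexOfK_conj (N := n) hP hK2 (locStencil_slice hTm hm0.le κ u) (half_pos hm0) b' w'
  -- distribute the congruence over `½ • (V₁ + V₂)`
  have hV : ∀ (b : Fin (d + 1)) (w : Site (d + 1)) (b' : Fin (d + 1)) (w' : Site (d + 1)),
      ∃ B : ℝ, ∀ x z a c, |vertex2OfK K n T b w b' w' x z a c| ≤ B := by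
    intro b w b' w'
    have h := SecondOrderResponse.vertexFamily₂_vertex2OfK (N := n) hKm (abs_nonneg CK) hTm hm0 b w b' w'
    exact ⟨_, fun x z a c => bdd_of_biLoc h (by positivity) x z a c⟩
  obtain ⟨B₁, hB₁⟩ := hV μ y ν y'
  obtain ⟨B₂, hB₂⟩ := hV ν y' μ y
  have hPt : Spr (trK P) := hP.trK
  -- bounds of the left-conjugated words (for the right distribution)
  obtain ⟨CP, δP, hδP, hPd⟩ := id hP
  have hPtV : ∀ {V : MKer (d + 1) (Fib d)} {B : ℝ}, (∀ x z a c, |V x z a c| ≤ B) → ∃ B' : ℝ, ∀ x z a c, |comp (trK P) V x z a c| ≤ B' := by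
    intro V B hVB
    have hB0 : 0 ≤ B := (abs_nonneg _).trans (hVB 0 0 (Sum.inl 0) (Sum.inl 0))
    exact ⟨_, fun x z a c => abs_comp_le_of_spr_left (decays_trK hPd) hδP hVB x z a c⟩
  obtain ⟨B₁', hB₁'⟩ := hPtV hB₁
  obtain ⟨B₂', hB₂'⟩ := hPtV hB₂
  unfold vsym
  have smul_comp : ∀ (c : ℝ) (A B : MKer (d + 1) (Fib d)), comp (c • A) B = c • comp A B := by
    intro c A B
    funext x z a e
    simp only [ExpKernelCalculus.comp, Pi.smul_apply, smul_eq_mul]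
    rw [← tsum_mul_left]
    refine tsum_congr fun y => ?_
    rw [Finset.mul_sum]
    exact Finset.sum_congr rfl fun _ _ => by ring
  rw [comp_smul_right, comp_add_of_bdd hPt hB₁ hB₂, smul_comp, add_comp_of_bdd hP hB₁' hB₂', conj2, conj2]

/-! ## §3 The linear step of a conjugated kernel -/

/-- [folklore] **THE SANDWICH WORD**: for spread `K`, `Ψ̂ = psiKS r n`, `K′ := Ψ̂ ∘ K ∘ Ψ̂ᵀ` and a localised `W`:
`K′ ∘ W ∘ K′ = Ψ̂ ∘ ((K ∘ (Ψ̂ᵀ ∘ W ∘ Ψ̂)) ∘ K) ∘ Ψ̂ᵀ` (tame re-association; road-P2 g55's M.45 `word` pattern, here as a lemma). -/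
theorem conj_sandwich {K W : MKer (d + 1) (Fib d)} (hK : Spr K) (hW : Loc W) :
    comp (comp (comp (comp (psiKS r n) K) (trK (psiKS r n))) W) (comp (comp (psiKS r n) K) (trK (psiKS r n)))
      = comp (comp (psiKS r n) (comp (comp K (comp (comp (trK (psiKS r n)) W) (psiKS r n))) K)) (trK (psiKS r n)) := by
  set P : MKer (d + 1) (Fib d) := psiKS r n with hP
  have hΨ : Spr P := spr_psiKS hn hr
  have hΨt : Spr (trK P) := hΨ.trK
  have hPK : Spr (comp P K) := spr_comp hΨ hK
  have hK' : Spr (comp (comp P K) (trK P)) := spr_comp hPK hΨt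
  have hPtW : Loc (comp (trK P) W) := hΨt.comp_loc hW
  have hA : Loc (comp K (comp (trK P) W)) := hK.comp_loc hPtW
  have hAP : Loc (comp (comp K (comp (trK P) W)) P) := hA.comp_spr hΨ
  have hX : Loc (comp K (comp (comp (trK P) W) P)) := hK.comp_loc (hPtW.comp_spr hΨ)
  have hZ : Loc (comp (comp K (comp (comp (trK P) W) P)) K) := hX.comp_spr hK
  have h1 : comp (comp (comp P K) (trK P)) W = comp P (comp K (comp (trK P) W)) := by
    rw [← comp_assoc_tame hPK.tame hΨt.tame hW.tame, ← comp_assoc_tame hΨ.tame hK.tame hPtW.tame]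
  have h2 : comp (comp K (comp (trK P) W)) (comp (comp P K) (trK P)) = comp (comp (comp K (comp (comp (trK P) W) P)) K) (trK P) := by
    rw [comp_assoc_tame hA.tame hPK.tame hΨt.tame, comp_assoc_tame hA.tame hΨ.tame hK.tame, ← comp_assoc_tame hK.tame hPtW.tame hΨ.tame]
  rw [h1, ← comp_assoc_tame hΨ.tame hA.tame hK'.tame, h2, comp_assoc_tame hΨ.tame hZ.tame hΨt.tame]

/-- **(C-1): THE LINEAR STEP OF A `Ψ̂_S`-CONJUGATED KERNEL IS THE LINEAR STEP ON THE FOUR-VARIABLE-TRANSPORTED BI-TABLE** [our bookkeeping; folklore composition]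
(spread `K`, `LocStencil₂` table at a positive rate, `0 < n`, `r ∈ box (d+1) n`, `Ψ̂ = psiKS r n`, any `c`, every slot pair and bond pair):
`lin4 c (Ψ̂ ∘ K ∘ Ψ̂ᵀ) n T κ u κ′ u′ = lin4 c K n (𝒯₄ T) κ u κ′ u′`, `𝒯₄ T κ₁ u₁ κ₂ u₂ := Ψ̂ᵀ ∘ slotPsiS r n (slotPsiS r n T κ₁ u₁) κ₂ u₂ ∘ Ψ̂` (left-first bracketing) —
§2 `vsym_conj_psiKS` (the two source slots), `conj_sandwich` + M.45 §1 `mmRead_conj_psiKS` (the outer correctors drop under the `mm`-read), §2 `conj_vsym_eq_vsym_conj` (the two kernel legs). -/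
theorem lin4_conj_psiKS {K : MKer (d + 1) (Fib d)} (hK : Spr K)
    {T : Fin (d + 1) → Site (d + 1) → Fin (d + 1) → Site (d + 1) → MKer (d + 1) (Fib d)} {CT δT : ℝ} (hT : LocStencil₂ T CT δT) (hδT : 0 < δT) (c : ℝ)
    (κ : Fin (d + 1)) (u : Site (d + 1)) (κ' : Fin (d + 1)) (u' : Site (d + 1)) :
    lin4 c (comp (comp (psiKS r n) K) (trK (psiKS r n))) n T κ u κ' u'
      = lin4 c K n (fun κ₁ u₁ κ₂ u₂ => comp (comp (trK (psiKS r n)) (slotPsiS r n (slotPsiS r n T κ₁ u₁) κ₂ u₂)) (psiKS r n)) κ u κ' u' := by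
  have hΨ : Spr (psiKS r n) := spr_psiKS hn hr
  -- the doubly slot-transported table is a `LocStencil₂` family (TT5)
  have hT₂ := locStencil₂_slotPsiS₂ hn r hT hδT.le
  -- its symmetrised bi-vertex through `K` is localised
  obtain ⟨CK, δK, hδK, hKd⟩ := id hK
  set m : ℝ := min δK δT with hm
  have hm0 : 0 < m := lt_min hδK hδT
  have hKm : Decays K (|CK|) m := decays_of_le hKd (min_le_left _ _)
  have hT₂m := hT₂.mono (min_le_right δK δT)
  have hW : Loc (vsym K n (fun α x => slotPsiS r n (slotPsiS r n T α x)) κ u κ' u') := by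
    have h := biLoc_vsym_far (N := n) hKm (abs_nonneg CK) hm0 hT₂m κ u κ' u'
    exact ⟨_, _, _, _, by positivity, h⟩
  rw [lin4_apply, lin4_apply, vsym_conj_psiKS hn hr hK hT hδT, conj_sandwich hn hr hK hW, mmRead_conj_psiKS,
    conj_vsym_eq_vsym_conj (n := n) hΨ hK hT₂ hδT κ u κ' u']

/-- [folklore] **(C-1), RIGHT-FIRST BRACKETING** (the form of `PsiLegDefectOfDivergences` ∕ `PsiTableDefectOfDivergences`): the same with `𝒯₄ T κ₁ u₁ κ₂ u₂ := Ψ̂ᵀ ∘ (slotPsiS r n (slotPsiS r n T κ₁ u₁) κ₂ u₂ ∘ Ψ̂)`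
(tame re-association of each localised slice, `TameKernelCalculus.comp_assoc_tame`). -/
theorem lin4_conj_psiKS' {K : MKer (d + 1) (Fib d)} (hK : Spr K)
    {T : Fin (d + 1) → Site (d + 1) → Fin (d + 1) → Site (d + 1) → MKer (d + 1) (Fib d)} {CT δT : ℝ} (hT : LocStencil₂ T CT δT) (hδT : 0 < δT) (c : ℝ)
    (κ : Fin (d + 1)) (u : Site (d + 1)) (κ' : Fin (d + 1)) (u' : Site (d + 1)) :
    lin4 c (comp (comp (psiKS r n) K) (trK (psiKS r n))) n T κ u κ' u'
      = lin4 c K n (fun κ₁ u₁ κ₂ u₂ => comp (trK (psiKS r n)) (comp (slotPsiS r n (slotPsiS r n T κ₁ u₁) κ₂ u₂) (psiKS r n))) κ u κ' u' := by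
  have hΨ : Spr (psiKS r n) := spr_psiKS hn hr
  have hT₂ := locStencil₂_slotPsiS₂ hn r hT hδT.le
  have e : (fun κ₁ u₁ κ₂ u₂ => comp (trK (psiKS r n)) (comp (slotPsiS r n (slotPsiS r n T κ₁ u₁) κ₂ u₂) (psiKS r n)))
      = fun κ₁ u₁ κ₂ u₂ => comp (comp (trK (psiKS r n)) (slotPsiS r n (slotPsiS r n T κ₁ u₁) κ₂ u₂)) (psiKS r n) := by
    funext κ₁ u₁ κ₂ u₂
    have hL : Loc (slotPsiS r n (slotPsiS r n T κ₁ u₁) κ₂ u₂) := ⟨_, _, _, _, hδT, hT₂ κ₁ u₁ κ₂ u₂⟩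
    exact comp_assoc_tame hΨ.trK.tame hL.tame hΨ.tame
  rw [e]
  exact lin4_conj_psiKS hn hr hK hT hδT c κ u κ' u'

end Summit.QuantumFields.BalabanUV.Beta.GAN24.CombLin4Transport

end
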